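import Mathlib
import HarnessLib
import Literature.NumberTheory.DiophantineGeometry.ConicParametrisationAlgebra

/-!
# Rational points on a diagonal conic: the local analysis in the chart `u = (s, t, 0)`

Continues `ConicParametrisationAlgebra.lean`. For the parametrising map
`conicMap A P u = F(u)P − 2⟨u,P⟩u` of the conic `F = A₀X₀² + A₁X₁² + A₂X₂² = 0` from a zero
`P = (α, β, γ)`, restricted to `u = (s, t, 0)` one has (`conicMap_chart`)
`conicMap A P (s,t,0) = (Fα − 2Ls, Fβ − 2Lt, Fγ)`, `F = A₀s² + A₁t²`, `L = A₀αs + A₁βt`.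
This file records the divisibility of these coordinates by a prime `p` dividing `A₀` — the
input for the `p`-adic densities of the primitive points of the conics
`y₀³x₀² + y₁³x₁² = y₂³x₂²` (Browning–Van Valckenborgh 2012, Lemmas 1–2, reached here through
the parametrisation rather than through Hensel's lemma):

* odd (indeed any) `p` with `v_p(A₀) = 1`, `p ∤ A₁βγ`: for `p ∤ t` the content is prime to `p`
  (`chart_not_dvd_X2`) and `p ∣ X₀ ↔ p ∣ αt − 2βs` (`chart_dvd_X0_iff`); for `p ∣ t`, `p ∤ s`
  the content has `p`-part exactly `p` (`chart_dvd_of_dvd_t`) and `p² ∣ X₀ ↔ p² ∣ A₀αs + 2A₁βt`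
  (`chart_sq_dvd_X0_iff`);
* `p = 2`: the parity/`mod 4` statements `chart2_X2_odd`, `chart2_dvd_X0_iff`,
  `chart2_of_t_even` (`2 ∥ A₀`), `chart2_of_s_t_odd` (all `Aᵢ` odd), and
  `two_dvd_fst_iff_eight_dvd`: for `2 ∥ A₀`, `A₁A₂βγ` odd and `F(P) = 0`, `α` is even iff
  `8 ∣ A₁ + A₂` — each reduced to a finite check in `ZMod 4`/`ZMod 8` done by `decide`.

Everything is proved (theorems only).

## References

* T. D. Browning, K. Van Valckenborgh, *Sums of three squareful numbers*, Exp. Math. 21 (2012)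
  204–211, §2.2 Lemmas 1–2, §3. [cite: BrowningValckenborgh2012, §2.2, §3]
-/

namespace Literature.NumberTheory.DiophantineGeometry

/-! ## The chart `u = (s, t, 0)`: local analysis at a prime dividing `A₀` -/

section Chart

variable {A P : ℤ × ℤ × ℤ}

/-- **The chart formulas.** For `u = (s, t, 0)`:
`conicMap A P u = (F α − 2L s, F β − 2L t, F γ)` with `F = A₀s² + A₁t²`,
`L = A₀αs + A₁βt`. [folklore] -/
theorem conicMap_chart (A P : ℤ × ℤ × ℤ) (s t : ℤ) :
    conicMap A P (s, t, 0) =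
      ((A.1 * s ^ 2 + A.2.1 * t ^ 2) * P.1 - 2 * (A.1 * P.1 * s + A.2.1 * P.2.1 * t) * s,
        (A.1 * s ^ 2 + A.2.1 * t ^ 2) * P.2.1 - 2 * (A.1 * P.1 * s + A.2.1 * P.2.1 * t) * t,
        (A.1 * s ^ 2 + A.2.1 * t ^ 2) * P.2.2) := by
  simp only [conicMap, ternForm, ternBilin, Prod.mk.injEq]
  refine ⟨by ring, by ring, by ring⟩

variable {p : ℕ}

/-- (O1) If `p ∤ A₁ γ t` (and `p ∣ A₀`) then `p ∤ X₂ = γ (A₀s² + A₁t²)`. [folklore] -/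
theorem chart_not_dvd_X2 (hp : p.Prime) (hA0 : (p : ℤ) ∣ A.1) (hA1 : ¬(p : ℤ) ∣ A.2.1)
    (hγ : ¬(p : ℤ) ∣ P.2.2) {s t : ℤ} (ht : ¬(p : ℤ) ∣ t) :
    ¬(p : ℤ) ∣ (conicMap A P (s, t, 0)).2.2 := by
  rw [conicMap_chart]
  simp only
  intro h
  have hp' : Prime (p : ℤ) := Nat.prime_iff_prime_int.1 hp
  have h1 : (p : ℤ) ∣ A.2.1 * t ^ 2 * P.2.2 := by
    have : (A.1 * s ^ 2 + A.2.1 * t ^ 2) * P.2.2 = A.1 * (s ^ 2 * P.2.2) + A.2.1 * t ^ 2 * P.2.2 := by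
      ring
    rw [this] at h
    exact (Int.dvd_add_right (hA0.mul_right _)).1 h
  rcases hp'.dvd_or_dvd h1 with h2 | h2
  · rcases hp'.dvd_or_dvd h2 with h3 | h3
    · exact hA1 h3
    · exact ht (hp'.dvd_of_dvd_pow h3)
  · exact hγ h2

/-- (O2) If `p ∣ A₀` and `p ∤ A₁ t` then `p ∣ X₀ ↔ p ∣ α t − 2 β s`
(`X₀ ≡ A₁ t (α t − 2 β s) (mod p)`). [folklore] -/
theorem chart_dvd_X0_iff (hp : p.Prime) (hA0 : (p : ℤ) ∣ A.1) (hA1 : ¬(p : ℤ) ∣ A.2.1)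
    {s t : ℤ} (ht : ¬(p : ℤ) ∣ t) :
    (p : ℤ) ∣ (conicMap A P (s, t, 0)).1 ↔ (p : ℤ) ∣ P.1 * t - 2 * P.2.1 * s := by
  rw [conicMap_chart]
  simp only
  have hp' : Prime (p : ℤ) := Nat.prime_iff_prime_int.1 hp
  have e : (A.1 * s ^ 2 + A.2.1 * t ^ 2) * P.1 - 2 * (A.1 * P.1 * s + A.2.1 * P.2.1 * t) * s =
      A.1 * (s ^ 2 * P.1 - 2 * P.1 * s * s) + A.2.1 * t * (P.1 * t - 2 * P.2.1 * s) := by ring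
  rw [e, Int.dvd_add_right (hA0.mul_right _)]
  constructor
  · intro h
    rcases hp'.dvd_or_dvd h with h | h
    · rcases hp'.dvd_or_dvd h with h | h
      · exact absurd h hA1
      · exact absurd h ht
    · exact h
  · intro h
    exact h.mul_left _

/-- (O3) If `v_p(A₀) = 1`, `p ∤ β`, `p ∣ t`, `p ∤ s` then `p` divides all three coordinates of
`conicMap A P (s,t,0)` and `p² ∤ X₁` (`X₁ ≡ A₀ s² β (mod p²)`): the content has `p`-part
exactly `p`. [folklore] -/
theorem chart_dvd_of_dvd_t (hp : p.Prime) (hA0 : (p : ℤ) ∣ A.1) (hA0' : ¬((p : ℤ) ^ 2 ∣ A.1))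
    (hβ : ¬(p : ℤ) ∣ P.2.1) {s t : ℤ} (ht : (p : ℤ) ∣ t) (hs : ¬(p : ℤ) ∣ s) :
    (p : ℤ) ∣ (conicMap A P (s, t, 0)).1 ∧ (p : ℤ) ∣ (conicMap A P (s, t, 0)).2.1 ∧
      (p : ℤ) ∣ (conicMap A P (s, t, 0)).2.2 ∧ ¬((p : ℤ) ^ 2 ∣ (conicMap A P (s, t, 0)).2.1) := by
  rw [conicMap_chart]
  simp only
  have hp' : Prime (p : ℤ) := Nat.prime_iff_prime_int.1 hp
  obtain ⟨a', ha'⟩ := hA0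
  obtain ⟨t', rfl⟩ := ht
  rw [ha'] at hA0' ⊢
  refine ⟨⟨a' * s ^ 2 * P.1 + p * A.2.1 * t' ^ 2 * P.1 - 2 * (a' * P.1 * s + A.2.1 * P.2.1 * t') * s,
      by ring⟩,
    ⟨a' * s ^ 2 * P.2.1 + p * A.2.1 * t' ^ 2 * P.2.1 -
        2 * p * (a' * P.1 * s + A.2.1 * P.2.1 * t') * t', by ring⟩,
    ⟨(a' * s ^ 2 + p * A.2.1 * t' ^ 2) * P.2.2, by ring⟩, ?_⟩
  intro h
  -- `X₁ = p (a' s² β) + p² (...)`, so `p² ∣ X₁` forces `p ∣ a' s² β`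
  have e : (p * a' * s ^ 2 + A.2.1 * (p * t') ^ 2) * P.2.1 -
      2 * (p * a' * P.1 * s + A.2.1 * P.2.1 * (p * t')) * (p * t') =
      (p : ℤ) ^ 2 * (A.2.1 * t' ^ 2 * P.2.1 - 2 * (a' * P.1 * s + A.2.1 * P.2.1 * t') * t') +
        p * (a' * s ^ 2 * P.2.1) := by ring
  rw [e, Int.dvd_add_right (dvd_mul_right _ _), pow_two, mul_dvd_mul_iff_left
    (by exact_mod_cast hp.ne_zero : (p : ℤ) ≠ 0)] at h
  have ha' : ¬(p : ℤ) ∣ a' := fun ha => hA0' (by rw [pow_two]; exact mul_dvd_mul_left _ ha)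
  rcases hp'.dvd_or_dvd h with h | h
  · rcases hp'.dvd_or_dvd h with h | h
    · exact ha' h
    · exact hs (hp'.dvd_of_dvd_pow h)
  · exact hβ h

/-- (O4) If `p ∣ t`, `p ∤ s` then `p² ∣ X₀ ↔ p² ∣ A₀αs + 2A₁βt`
(`X₀ = −s(A₀αs + 2A₁βt) + A₁αt²`). [folklore] -/
theorem chart_sq_dvd_X0_iff (hp : p.Prime) {s t : ℤ} (ht : (p : ℤ) ∣ t) (hs : ¬(p : ℤ) ∣ s) :
    (p : ℤ) ^ 2 ∣ (conicMap A P (s, t, 0)).1 ↔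
      (p : ℤ) ^ 2 ∣ A.1 * P.1 * s + 2 * A.2.1 * P.2.1 * t := by
  rw [conicMap_chart]
  simp only
  have hp' : Prime (p : ℤ) := Nat.prime_iff_prime_int.1 hp
  have e : (A.1 * s ^ 2 + A.2.1 * t ^ 2) * P.1 - 2 * (A.1 * P.1 * s + A.2.1 * P.2.1 * t) * s =
      A.2.1 * P.1 * (t * t) + (-s) * (A.1 * P.1 * s + 2 * A.2.1 * P.2.1 * t) := by ring
  have h2 : (p : ℤ) ^ 2 ∣ A.2.1 * P.1 * (t * t) := by
    rw [pow_two]; exact (mul_dvd_mul ht ht).mul_left _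
  rw [e, Int.dvd_add_right h2]
  constructor
  · intro h
    have hcop : IsCoprime ((p : ℤ) ^ 2) (-s) :=
      (((Prime.coprime_iff_not_dvd hp').2 hs).pow_left).neg_right
    exact hcop.dvd_of_dvd_mul_left h
  · intro h
    exact h.mul_left _

end Chart


/-! ## The chart `u = (s, t, 0)`: local analysis at `p = 2`

All `2`-adic statements below are reduced to finite checks in `ZMod 4` (or `ZMod 8`) by casting;
`decide` does the check. -/

section ChartTwo

variable {A P : ℤ × ℤ × ℤ}

/-! ### Casting parities to `ZMod 4` and `ZMod 8` -/

/-- Residues modulo `4` of an odd integer. [folklore] -/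
theorem cast_zmod_four_of_odd {z : ℤ} (hz : ¬(2 : ℤ) ∣ z) :
    (z : ZMod 4) = 1 ∨ (z : ZMod 4) = 3 := by
  have h : z % 4 = 1 ∨ z % 4 = 3 := by omega
  have e := ZMod.intCast_mod z 4
  push_cast at e
  rw [← e]
  rcases h with h | h <;> rw [h] <;> decide

/-- Residues modulo `4` of an even integer. [folklore] -/
theorem cast_zmod_four_of_even {z : ℤ} (hz : (2 : ℤ) ∣ z) :
    (z : ZMod 4) = 0 ∨ (z : ZMod 4) = 2 := by
  have h : z % 4 = 0 ∨ z % 4 = 2 := by omega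
  have e := ZMod.intCast_mod z 4
  push_cast at e
  rw [← e]
  rcases h with h | h <;> rw [h] <;> decide

/-- Residue modulo `4` of an integer `≡ 2 (mod 4)`. [folklore] -/
theorem cast_zmod_four_of_two_dvd_not_four_dvd {z : ℤ} (h2 : (2 : ℤ) ∣ z) (h4 : ¬(4 : ℤ) ∣ z) :
    (z : ZMod 4) = 2 := by
  have h : z % 4 = 2 := by omega
  have e := ZMod.intCast_mod z 4
  push_cast at e
  rw [← e, h]
  decide

/-- `2 ∣ z ↔ (z : ZMod 4) ∈ {0, 2}`. [folklore] -/
theorem two_dvd_iff_cast_zmod_four (z : ℤ) :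
    (2 : ℤ) ∣ z ↔ ((z : ZMod 4) = 0 ∨ (z : ZMod 4) = 2) := by
  constructor
  · exact cast_zmod_four_of_even
  · intro h
    by_contra h2
    rcases cast_zmod_four_of_odd h2 with h' | h' <;> rcases h with h | h <;> rw [h'] at h <;>
      revert h <;> decide

/-- `4 ∣ z ↔ (z : ZMod 4) = 0`. [folklore] -/
theorem four_dvd_iff_cast_zmod_four (z : ℤ) : (4 : ℤ) ∣ z ↔ (z : ZMod 4) = 0 := by
  rw [show (4 : ℤ) = ((4 : ℕ) : ℤ) by norm_num, ZMod.intCast_zmod_eq_zero_iff_dvd]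

/-- Residues modulo `8` of an odd integer. [folklore] -/
theorem cast_zmod_eight_of_odd {z : ℤ} (hz : ¬(2 : ℤ) ∣ z) :
    (z : ZMod 8) = 1 ∨ (z : ZMod 8) = 3 ∨ (z : ZMod 8) = 5 ∨ (z : ZMod 8) = 7 := by
  have h : z % 8 = 1 ∨ z % 8 = 3 ∨ z % 8 = 5 ∨ z % 8 = 7 := by omega
  have e := ZMod.intCast_mod z 8
  push_cast at e
  rw [← e]
  rcases h with h | h | h | h <;> rw [h] <;> decide

/-- Residues modulo `8` of an integer `≡ 2 (mod 4)`. [folklore] -/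
theorem cast_zmod_eight_of_two_dvd_not_four_dvd {z : ℤ} (h2 : (2 : ℤ) ∣ z) (h4 : ¬(4 : ℤ) ∣ z) :
    (z : ZMod 8) = 2 ∨ (z : ZMod 8) = 6 := by
  have h : z % 8 = 2 ∨ z % 8 = 6 := by omega
  have e := ZMod.intCast_mod z 8
  push_cast at e
  rw [← e]
  rcases h with h | h <;> rw [h] <;> decide

/-- `2 ∣ z ↔ (z : ZMod 8) ∈ {0, 2, 4, 6}`. [folklore] -/
theorem two_dvd_iff_cast_zmod_eight (z : ℤ) :
    (2 : ℤ) ∣ z ↔ ((z : ZMod 8) = 0 ∨ (z : ZMod 8) = 2 ∨ (z : ZMod 8) = 4 ∨ (z : ZMod 8) = 6) := by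
  constructor
  · intro hz
    have h : z % 8 = 0 ∨ z % 8 = 2 ∨ z % 8 = 4 ∨ z % 8 = 6 := by omega
    have e := ZMod.intCast_mod z 8
    push_cast at e
    rw [← e]
    rcases h with h | h | h | h <;> rw [h] <;> decide
  · intro h
    by_contra h2
    rcases cast_zmod_eight_of_odd h2 with h' | h' | h' | h' <;> rw [h'] at h <;> revert h <;> decide

/-- `8 ∣ z ↔ (z : ZMod 8) = 0`. [folklore] -/
theorem eight_dvd_iff_cast_zmod_eight (z : ℤ) : (8 : ℤ) ∣ z ↔ (z : ZMod 8) = 0 := by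
  rw [show (8 : ℤ) = ((8 : ℕ) : ℤ) by norm_num, ZMod.intCast_zmod_eq_zero_iff_dvd]

/-! ### The finite checks

(`decide` over `ZMod 4`/`ZMod 8`; the nested quantifiers need a larger instance-search budget,
whence the two `synthInstance` options — they only affect instance search, not the kernel check.) -/

set_option synthInstance.maxSize 8192 in
set_option synthInstance.maxHeartbeats 400000 in
/-- Core of (T1) in `ZMod 4`. [folklore] -/
theorem zmod4_T1 : ∀ a0 a1 s t g : ZMod 4, (a0 * s = 0 ∨ a0 * s = 2) → (a1 = 1 ∨ a1 = 3) →
    (g = 1 ∨ g = 3) → (t = 1 ∨ t = 3) →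
    ((a0 * s ^ 2 + a1 * t ^ 2) * g = 1 ∨ (a0 * s ^ 2 + a1 * t ^ 2) * g = 3) := by
  decide

set_option synthInstance.maxSize 8192 in
set_option synthInstance.maxHeartbeats 400000 in
/-- Core of (T2) in `ZMod 4`. [folklore] -/
theorem zmod4_T2 : ∀ a0 a1 s t al be : ZMod 4, (a0 = 0 ∨ a0 = 2) → (a1 = 1 ∨ a1 = 3) →
    (t = 1 ∨ t = 3) →
    ((((a0 * s ^ 2 + a1 * t ^ 2) * al - 2 * (a0 * al * s + a1 * be * t) * s = 0 ∨
      (a0 * s ^ 2 + a1 * t ^ 2) * al - 2 * (a0 * al * s + a1 * be * t) * s = 2)) ↔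
      (al = 0 ∨ al = 2)) := by
  decide

set_option synthInstance.maxSize 8192 in
set_option synthInstance.maxHeartbeats 400000 in
/-- Core of (T3) in `ZMod 4`. [folklore] -/
theorem zmod4_T3 : ∀ a1 s t al be g : ZMod 4, (a1 = 1 ∨ a1 = 3) → (s = 1 ∨ s = 3) →
    (t = 0 ∨ t = 2) → (be = 1 ∨ be = 3) → (g = 1 ∨ g = 3) →
    (((2 * s ^ 2 + a1 * t ^ 2) * al - 2 * (2 * al * s + a1 * be * t) * s = 0 ∨
        (2 * s ^ 2 + a1 * t ^ 2) * al - 2 * (2 * al * s + a1 * be * t) * s = 2) ∧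
      (2 * s ^ 2 + a1 * t ^ 2) * be - 2 * (2 * al * s + a1 * be * t) * t = 2 ∧
      ((2 * s ^ 2 + a1 * t ^ 2) * g = 0 ∨ (2 * s ^ 2 + a1 * t ^ 2) * g = 2) ∧
      ((2 * s ^ 2 + a1 * t ^ 2) * al - 2 * (2 * al * s + a1 * be * t) * s = 0 ↔
        (al = 0 ∨ al = 2))) := by
  decide

set_option synthInstance.maxSize 8192 in
set_option synthInstance.maxHeartbeats 400000 in
/-- Core of (T4) in `ZMod 4`. [folklore] -/
theorem zmod4_T4 : ∀ a0 a1 s t al be : ZMod 4, (a0 = 1 ∨ a0 = 3) → (a1 = 1 ∨ a1 = 3) →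
    (s = 1 ∨ s = 3) → (t = 1 ∨ t = 3) →
    (((al = 0 ∨ al = 2) ∧ (be = 1 ∨ be = 3)) ∨ ((al = 1 ∨ al = 3) ∧ (be = 0 ∨ be = 2))) →
    (((a0 * s ^ 2 + a1 * t ^ 2) * al - 2 * (a0 * al * s + a1 * be * t) * s = 0 ∨
        (a0 * s ^ 2 + a1 * t ^ 2) * al - 2 * (a0 * al * s + a1 * be * t) * s = 2) ∧
      ((a0 * s ^ 2 + a1 * t ^ 2) * be - 2 * (a0 * al * s + a1 * be * t) * t = 0 ∨
        (a0 * s ^ 2 + a1 * t ^ 2) * be - 2 * (a0 * al * s + a1 * be * t) * t = 2) ∧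
      (a0 * s ^ 2 + a1 * t ^ 2 = 0 ∨ a0 * s ^ 2 + a1 * t ^ 2 = 2) ∧
      ¬((a0 * s ^ 2 + a1 * t ^ 2) * al - 2 * (a0 * al * s + a1 * be * t) * s = 0 ∧
        (a0 * s ^ 2 + a1 * t ^ 2) * be - 2 * (a0 * al * s + a1 * be * t) * t = 0)) := by
  decide

set_option synthInstance.maxSize 8192 in
set_option synthInstance.maxHeartbeats 400000 in
/-- Odd squares are `1` modulo `8`. [folklore] -/
theorem zmod8_sq_of_odd : ∀ x : ZMod 8, (x = 1 ∨ x = 3 ∨ x = 5 ∨ x = 7) → x ^ 2 = 1 := by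
  decide

set_option synthInstance.maxSize 8192 in
set_option synthInstance.maxHeartbeats 400000 in
/-- Core of (T5) in `ZMod 8`. [folklore] -/
theorem zmod8_T5 : ∀ a0 a1 a2 al : ZMod 8, (a0 = 2 ∨ a0 = 6) →
    (a1 = 1 ∨ a1 = 3 ∨ a1 = 5 ∨ a1 = 7) → (a2 = 1 ∨ a2 = 3 ∨ a2 = 5 ∨ a2 = 7) →
    a0 * al ^ 2 + a1 + a2 = 0 →
    ((al = 0 ∨ al = 2 ∨ al = 4 ∨ al = 6) ↔ a1 + a2 = 0) := by
  decide

/-! ### The `2`-adic chart statements -/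

/-- (T1) If `A₀ s` is even, `A₁`, `γ`, `t` odd, then `X₂ = (A₀s² + A₁t²) γ` is odd: the content
is odd. [folklore] -/
theorem chart2_X2_odd {s t : ℤ} (hA0s : (2 : ℤ) ∣ A.1 * s) (hA1 : ¬(2 : ℤ) ∣ A.2.1)
    (hγ : ¬(2 : ℤ) ∣ P.2.2) (ht : ¬(2 : ℤ) ∣ t) : ¬(2 : ℤ) ∣ (conicMap A P (s, t, 0)).2.2 := by
  rw [conicMap_chart]
  simp only
  rw [two_dvd_iff_cast_zmod_four]
  push_cast
  have h1 := cast_zmod_four_of_even hA0s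
  push_cast at h1
  have h := zmod4_T1 (A.1 : ZMod 4) (A.2.1 : ZMod 4) (s : ZMod 4) (t : ZMod 4) (P.2.2 : ZMod 4)
    h1 (cast_zmod_four_of_odd hA1) (cast_zmod_four_of_odd hγ) (cast_zmod_four_of_odd ht)
  rcases h with h | h <;> rw [h] <;> decide

/-- (T2) If `A₀` is even and `A₁`, `t` odd, then `2 ∣ X₀ ↔ 2 ∣ α` (`X₀ ≡ F α ≡ α`). [folklore] -/
theorem chart2_dvd_X0_iff {s t : ℤ} (hA0 : (2 : ℤ) ∣ A.1) (hA1 : ¬(2 : ℤ) ∣ A.2.1)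
    (ht : ¬(2 : ℤ) ∣ t) : (2 : ℤ) ∣ (conicMap A P (s, t, 0)).1 ↔ (2 : ℤ) ∣ P.1 := by
  rw [conicMap_chart]
  simp only
  rw [two_dvd_iff_cast_zmod_four, two_dvd_iff_cast_zmod_four]
  push_cast
  exact zmod4_T2 (A.1 : ZMod 4) (A.2.1 : ZMod 4) (s : ZMod 4) (t : ZMod 4) (P.1 : ZMod 4)
    (P.2.1 : ZMod 4) (cast_zmod_four_of_even hA0) (cast_zmod_four_of_odd hA1)
    (cast_zmod_four_of_odd ht)

/-- (T3) If `2 ∥ A₀`, `A₁, β, γ` odd, `s` odd and `t` even, then all coordinates of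
`conicMap A P (s,t,0)` are even, `4 ∤ X₁` (content has `2`-part exactly `2`), and
`4 ∣ X₀ ↔ 2 ∣ α`. [folklore] -/
theorem chart2_of_t_even {s t : ℤ} (hA0 : (2 : ℤ) ∣ A.1) (hA0' : ¬(4 : ℤ) ∣ A.1)
    (hA1 : ¬(2 : ℤ) ∣ A.2.1) (hβ : ¬(2 : ℤ) ∣ P.2.1) (hγ : ¬(2 : ℤ) ∣ P.2.2)
    (hs : ¬(2 : ℤ) ∣ s) (ht : (2 : ℤ) ∣ t) :
    (2 : ℤ) ∣ (conicMap A P (s, t, 0)).1 ∧ (2 : ℤ) ∣ (conicMap A P (s, t, 0)).2.1 ∧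
      (2 : ℤ) ∣ (conicMap A P (s, t, 0)).2.2 ∧ ¬((4 : ℤ) ∣ (conicMap A P (s, t, 0)).2.1) ∧
      ((4 : ℤ) ∣ (conicMap A P (s, t, 0)).1 ↔ (2 : ℤ) ∣ P.1) := by
  rw [conicMap_chart]
  simp only
  rw [two_dvd_iff_cast_zmod_four, two_dvd_iff_cast_zmod_four, two_dvd_iff_cast_zmod_four,
    two_dvd_iff_cast_zmod_four, four_dvd_iff_cast_zmod_four, four_dvd_iff_cast_zmod_four]
  push_cast
  rw [cast_zmod_four_of_two_dvd_not_four_dvd hA0 hA0']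
  obtain ⟨h1, h2, h3, h4⟩ := zmod4_T3 (A.2.1 : ZMod 4) (s : ZMod 4) (t : ZMod 4) (P.1 : ZMod 4)
    (P.2.1 : ZMod 4) (P.2.2 : ZMod 4) (cast_zmod_four_of_odd hA1)
    (cast_zmod_four_of_odd hs) (cast_zmod_four_of_even ht) (cast_zmod_four_of_odd hβ)
    (cast_zmod_four_of_odd hγ)
  refine ⟨h1, Or.inr h2, h3, by rw [h2]; decide, h4⟩

/-- (T4) If `A₀, A₁, s, t` are odd and exactly one of `α, β` is even, then all coordinates of
`conicMap A P (s,t,0)` are even but `X₀, X₁` are not both divisible by `4` (content has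
`2`-part exactly `2`). [folklore] -/
theorem chart2_of_s_t_odd {s t : ℤ} (hA0 : ¬(2 : ℤ) ∣ A.1) (hA1 : ¬(2 : ℤ) ∣ A.2.1)
    (hs : ¬(2 : ℤ) ∣ s) (ht : ¬(2 : ℤ) ∣ t)
    (hαβ : ((2 : ℤ) ∣ P.1 ∧ ¬(2 : ℤ) ∣ P.2.1) ∨ (¬(2 : ℤ) ∣ P.1 ∧ (2 : ℤ) ∣ P.2.1)) :
    (2 : ℤ) ∣ (conicMap A P (s, t, 0)).1 ∧ (2 : ℤ) ∣ (conicMap A P (s, t, 0)).2.1 ∧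
      (2 : ℤ) ∣ (conicMap A P (s, t, 0)).2.2 ∧
      ¬((4 : ℤ) ∣ (conicMap A P (s, t, 0)).1 ∧ (4 : ℤ) ∣ (conicMap A P (s, t, 0)).2.1) := by
  rw [conicMap_chart]
  simp only
  have hαβ' : (((P.1 : ZMod 4) = 0 ∨ (P.1 : ZMod 4) = 2) ∧ ((P.2.1 : ZMod 4) = 1 ∨
      (P.2.1 : ZMod 4) = 3)) ∨ (((P.1 : ZMod 4) = 1 ∨ (P.1 : ZMod 4) = 3) ∧
      ((P.2.1 : ZMod 4) = 0 ∨ (P.2.1 : ZMod 4) = 2)) := by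
    rcases hαβ with ⟨h1, h2⟩ | ⟨h1, h2⟩
    · exact Or.inl ⟨cast_zmod_four_of_even h1, cast_zmod_four_of_odd h2⟩
    · exact Or.inr ⟨cast_zmod_four_of_odd h1, cast_zmod_four_of_even h2⟩
  obtain ⟨h1, h2, h3, h4⟩ := zmod4_T4 (A.1 : ZMod 4) (A.2.1 : ZMod 4) (s : ZMod 4) (t : ZMod 4)
    (P.1 : ZMod 4) (P.2.1 : ZMod 4) (cast_zmod_four_of_odd hA0)
    (cast_zmod_four_of_odd hA1) (cast_zmod_four_of_odd hs) (cast_zmod_four_of_odd ht) hαβ'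
  refine ⟨?_, ?_, ?_, ?_⟩
  · rw [two_dvd_iff_cast_zmod_four]; push_cast; exact h1
  · rw [two_dvd_iff_cast_zmod_four]; push_cast; exact h2
  · have hF : (2 : ℤ) ∣ A.1 * s ^ 2 + A.2.1 * t ^ 2 := by
      rw [two_dvd_iff_cast_zmod_four]; push_cast; exact h3
    exact hF.mul_right _
  · rw [four_dvd_iff_cast_zmod_four, four_dvd_iff_cast_zmod_four]; push_cast; exact h4

/-- (T5) **The parity of `α` is decided by the coefficients**: if `2 ∥ A₀`, `A₁, A₂, β, γ` are
odd and `F(P) = 0`, then `α` is even iff `8 ∣ A₁ + A₂` (odd squares are `1 (mod 8)`).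
[folklore] -/
theorem two_dvd_fst_iff_eight_dvd (hA0 : (2 : ℤ) ∣ A.1) (hA0' : ¬(4 : ℤ) ∣ A.1)
    (hA1 : ¬(2 : ℤ) ∣ A.2.1) (hA2 : ¬(2 : ℤ) ∣ A.2.2) (hβ : ¬(2 : ℤ) ∣ P.2.1)
    (hγ : ¬(2 : ℤ) ∣ P.2.2) (hP : ternForm A P = 0) :
    (2 : ℤ) ∣ P.1 ↔ (8 : ℤ) ∣ A.2.1 + A.2.2 := by
  rw [two_dvd_iff_cast_zmod_eight, eight_dvd_iff_cast_zmod_eight]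
  push_cast
  have hP' : ((ternForm A P : ℤ) : ZMod 8) = 0 := by rw [hP, Int.cast_zero]
  simp only [ternForm] at hP'
  push_cast at hP'
  rw [zmod8_sq_of_odd _ (cast_zmod_eight_of_odd hβ), zmod8_sq_of_odd _ (cast_zmod_eight_of_odd hγ),
    mul_one, mul_one] at hP'
  exact zmod8_T5 (A.1 : ZMod 8) (A.2.1 : ZMod 8) (A.2.2 : ZMod 8) (P.1 : ZMod 8)
    (cast_zmod_eight_of_two_dvd_not_four_dvd hA0 hA0') (cast_zmod_eight_of_odd hA1)
    (cast_zmod_eight_of_odd hA2) hP'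


end ChartTwo

end Literature.NumberTheory.DiophantineGeometry
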